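import Summits.BirchSwinnertonDyer.BirchSwinnertonDyer.Theorems.KatoDescentTamePotSupersingularTameUpperNonsurjTowerReduction
import Summits.BirchSwinnertonDyer.Rank1Residual.Additive.X4RankZeroKatoBoundTamagawaExact
import Literature.NumberTheory.EllipticCurves.Kato2004.AdditivePotGoodRankZeroShaUpperBoundFineSelmer
import HarnessLib

/-!
# Route `KatoDescentTamePotSupersingular` (rung K8, sub-rung B4 (t′), cell `bsd-potss`): the row crux
# `TameUpperNonsurjTower` (U₀-ns, item stmt-BirchSwinnertonDyer-19202) REDUCED TO ONE NAMED QUANTITY —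
# the finite generation over `ℤ_p` of the dual fine Selmer group `Y(E/ℚ^cyc)` (Coates–Sujatha's
# statement (A)) on its NON-CM rows (a `--supports` file)

The crux asks for the upper half `ord_p #Ш ≤ ord_p #Ш_an` on the rank-`0` (t′) rows with `E[p]`
IRREDUCIBLE but `p`-adic tower image NOT onto — the rows where Kato's (12.5.2) fails and A161″
(`X4RankZero.missingUpperBoundAt_of_katoTam`) does not apply. The Literature reading
`Kato2004.rankZero_padicValNat_sha_add_padicValNat_tamagawa_le_of_additive_potGood_of_irreducible_of_fineSelmerDual_fg`
(file `Kato2004/AdditivePotGoodRankZeroShaUpperBoundFineSelmer.lean`: Kato Thm. 12.4 (3) + 13.14 +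
Thm. 12.5 (3) [height-one primes not containing `p`, NO image hypothesis] + 14.14/Lemma 14.15 [only
the trivial-character component enters 14.5 (3)] + Lim 2017 §3 [`Y` f.g. iff `H²_S` f.g.]) gives
the SAME Tamagawa-exact bound as A161″ with (12.5.2) replaced by «`E[p]` irreducible ∧ `Y(E/ℚ^cyc)`
finitely generated over `ℤ_p`». Hence:

* `padicValNat_shaOrder_le_of_katoFineSelmer_rankZero`, `missingUpperBoundAt_tame_of_irreducible_of_fineSelmerDual_fg`
  — the bookkeeping twin of `Additive.padicValNat_shaOrder_le_of_katoTam_rankZero` /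
  `X4RankZero.missingUpperBoundAt_of_katoTam` (`#Ш_an = (L/Ω)·#tors²/Tam`, torsion term killed by
  irreducibility): on ANY rank-`0` odd additive potentially good row with `E[p]` irreducible, the
  finite-generation hypothesis at `(E,p)` gives `MissingUpperBoundAt W p`;
* `tameUpperNonsurjTower_of_cm_of_fineSelmerDual_fg` — the RESHAPED COMPOSITION of the row crux BY
  NAME: granted the reading, the CM triple (row C8, `missingUpperBoundAt_of_hasCM_rankZero`),
  modularity and GZK, `TameUpperNonsurjTower` follows from the finite generation of `Y(E/ℚ^cyc)` over
  `ℤ_p` on the NON-CM rank-`0` (t′) rows with `E[p]` irreducible and tower not onto — ONE named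
  statement per row (unproved in general; proved in print when `E` admits a `p`-isogeny, which these
  rows exclude), replacing the amorphous "index error" of the item's why-it-might-fail.

Nothing about the finite-generation statement, the reading or the named facts is asserted; the item
is NOT closed (conditional helper). Seat `bsd-potss-k8t-c4`.

References: [Kato2004Asterisque] Thm. 12.4 (3) (p. 221), Thm. 12.5 (3) (p. 222), 13.14 (p. 234),
Thm. 14.5 (3) (p. 236), 14.14 + Lemma 14.15 (pp. 243–244), Prop. 14.16 (2) (p. 244), §14.8 (p. 238);
[Lim2017FineSelmer] §3; [CoatesSujatha2005]; [GreenbergLNM1716] Prop. 4.13; [Miller2011LMS] Def. 1.1.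
-/

set_option autoImplicit false
-- sibling precedent (`KatoDescentTamePotSupersingularAssembly.lean`): the directory name repeats the summit name
set_option linter.dupNamespace false

noncomputable section

open scoped Classical

namespace Summit.BirchSwinnertonDyer.BirchSwinnertonDyer.Theorems

open WeierstrassCurve Literature.NumberTheory.EllipticCurves
  Literature.NumberTheory.EllipticCurves.ModularForms
  Literature.NumberTheory.EllipticCurves.Rank1Residual
  Literature.NumberTheory.EllipticCurves.Rank1Residual.Typed
  Summit.BirchSwinnertonDyer.Rank1Residual.Additive
  Summit.BirchSwinnertonDyer.Rank1Residual
  Summit.BirchSwinnertonDyer.BirchSwinnertonDyer.Theses.KatoDescentTamePotSupersingular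

/-- **Rank-`0` upper bound with the torsion term from the fine-Selmer reading**: at an odd additive
potentially good `p` with `E[p]` irreducible and `Y(E/ℚ^cyc)` finitely generated over `ℤ_p` (`hA`),
`#Ш_an = q` and `ord_p #Ш ≤ ord_p q − 2 ord_p #E(ℚ)_tors` — NO Tamagawa term (the reading bounds
`ord_p #Ш + v_p(∏c_ℓ)` by `ord_p(L/Ω)` and `#Ш_an = (L/Ω)·#tors²/∏c_ℓ`). Bookkeeping twin of
`Additive.padicValNat_shaOrder_le_of_katoTam_rankZero`.
[cite: Kato2004Asterisque, Thm. 14.5 (3) (p. 236), Thm. 12.5 (3) (p. 222), 14.14 (p. 243), Prop. 14.16 (2) (p. 244), §14.8 (p. 238)]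
[cite: Lim2017FineSelmer, §3] [cite: GreenbergLNM1716, §4 Prop. 4.13; §3 Lemma 3.3] [cite: Miller2011LMS, Def. 1.1] -/
theorem padicValNat_shaOrder_le_of_katoFineSelmer_rankZero
    (hKatoA :
      Kato2004.rankZero_padicValNat_sha_add_padicValNat_tamagawa_le_of_additive_potGood_of_irreducible_of_fineSelmerDual_fg)
    (hGZK : rank_eq_analyticRank_of_analyticRank_le_one) (hmod : hasEntireLFunction_rat)
    (W : WeierstrassCurve ℚ) [W.IsElliptic] [W.IsGloballyMinimal] (p : ℕ) [Fact p.Prime]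
    (hp : p ≠ 2) (hgood : ¬ W.HasGoodReductionAtPrime p) (hmult : ¬ W.HasMultiplicativeReductionAtPrime p)
    (hpot : 0 ≤ padicValRat p W.j) (hirr : W.HasIrreducibleModPGaloisRep p)
    (hA : ∀ (κ : ZpExtension ℚ p), κ.IsCyclotomic →
      ∃ (γ : Field.absoluteGaloisGroup ℚ) (D : W.FineSelmerDualData κ γ),
        Module.Finite ℤ_[p] (RestrictScalars ℤ_[p] (IwasawaAlgebra p) D.X))
    (hr : W.analyticRank = 0) :
    ∃ q : ℚ, shaAn W = (q : ℂ) ∧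
      (padicValNat p W.shaOrder : ℤ) ≤ padicValRat p q - 2 * padicValNat p W.torsionOrder := by
  have hL : W.entireLFunction 1 ≠ 0 := (W.analyticRank_eq_zero_iff_holds (hmod W)).mp hr
  obtain ⟨hmw, hfin⟩ := hGZK W (by rw [hr]; exact zero_le_one)
  haveI : Finite W.sha := hfin
  have hmw0 : W.mordellWeilRank = 0 := by rw [hmw, hr]
  obtain ⟨q₀, hq₀, hle⟩ := hKatoA W p hp hgood hmult hpot hirr hA hL hfin
  have hΩpos : 0 < W.realPeriodRat := W.realPeriodRat_pos_holds
  have hΩ : (W.realPeriodRat : ℂ) ≠ 0 := by exact_mod_cast hΩpos.ne'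
  have hc0 : 0 < W.tamagawaProduct := W.tamagawaProduct_pos_holds
  have ht0 : 0 < W.torsionOrder := W.torsionOrder_pos_holds
  have hq₀0 : q₀ ≠ 0 := by
    rintro rfl
    rw [Rat.cast_zero, div_eq_zero_iff] at hq₀
    exact hq₀.elim hL hΩ
  refine ⟨q₀ * (W.torsionOrder : ℚ) ^ 2 / (W.tamagawaProduct : ℚ), ?_, ?_⟩
  · have hLq : W.entireLFunction 1 = (q₀ : ℂ) * (W.realPeriodRat : ℂ) := by
      rw [← hq₀, div_mul_cancel₀ _ hΩ]
    rw [shaAn_def, leadingLCoeff_eq_of_analyticRank_eq_zero W hr,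
      W.regulator_eq_one_of_rank_zero hmw0, hLq]
    push_cast
    field_simp
  · have ht : (W.torsionOrder : ℚ) ≠ 0 := by exact_mod_cast ht0.ne'
    have hcq : (W.tamagawaProduct : ℚ) ≠ 0 := by exact_mod_cast hc0.ne'
    have hsha : padicValNat p (Nat.card (AddCommGroup.primaryComponent W.sha p)) =
        padicValNat p W.shaOrder := by
      unfold WeierstrassCurve.shaOrder
      exact padicValNat_card_addPrimaryComponent p
    have hv : padicValRat p (q₀ * (W.torsionOrder : ℚ) ^ 2 / (W.tamagawaProduct : ℚ)) =
        padicValRat p q₀ + 2 * (padicValNat p W.torsionOrder : ℤ) -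
          (padicValNat p W.tamagawaProduct : ℤ) := by
      rw [padicValRat.div (mul_ne_zero hq₀0 (pow_ne_zero 2 ht)) hcq,
        padicValRat.mul hq₀0 (pow_ne_zero 2 ht), pow_two, padicValRat.mul ht ht,
        padicValRat.of_nat, padicValRat.of_nat]
      ring
    rw [hv, ← hsha]
    linarith

/-- **The upper half on an irreducible rank-`0` (t′) row from the finite generation of `Y(E/ℚ^cyc)`
over `ℤ_p`** (any image size; `ord_p j ≥ 0` from `ClassO5`; torsion term killed by irreducibility):
granted the fine-Selmer reading, GZK and modularity, `hA` at `(E,p)` gives `MissingUpperBoundAt W p`.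
Twin of `X4RankZero.missingUpperBoundAt_of_katoTam` with tower surjectivity replaced by `hA`.
[cite: Kato2004Asterisque, Thm. 14.5 (3) (p. 236), Thm. 12.5 (3) (p. 222), 14.14 (p. 243)]
[cite: Lim2017FineSelmer, §3] [cite: Miller2011LMS, Def. 1.1] -/
theorem missingUpperBoundAt_tame_of_irreducible_of_fineSelmerDual_fg
    (hKatoA :
      Kato2004.rankZero_padicValNat_sha_add_padicValNat_tamagawa_le_of_additive_potGood_of_irreducible_of_fineSelmerDual_fg)
    (hGZK : rank_eq_analyticRank_of_analyticRank_le_one) (hmod : hasEntireLFunction_rat)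
    (W : WeierstrassCurve ℚ) [W.IsElliptic] [W.IsGloballyMinimal] (p : ℕ) [Fact p.Prime]
    (hr : W.analyticRank = 0) (hp2 : p ≠ 2) (hadd : Addv W p) (hT : SubTprime W p)
    (hirr : W.HasIrreducibleModPGaloisRep p)
    (hA : ∀ (κ : ZpExtension ℚ p), κ.IsCyclotomic →
      ∃ (γ : Field.absoluteGaloisGroup ℚ) (D : W.FineSelmerDualData κ γ),
        Module.Finite ℤ_[p] (RestrictScalars ℤ_[p] (IwasawaAlgebra p) D.X)) :
    MissingUpperBoundAt W p := by
  have hO5 : ClassO5 W p := ⟨hp2, hadd, Or.inr hT⟩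
  obtain ⟨q, hq, hle⟩ :=
    padicValNat_shaOrder_le_of_katoFineSelmer_rankZero hKatoA hGZK hmod W p hp2 hadd.1 hadd.2
      hO5.padicValRat_j_nonneg hirr hA hr
  refine ⟨q, hq, ?_⟩
  rw [padicValNat_torsionOrder_eq_zero_of_irreducible W p hirr] at hle
  simpa using hle

/-- **RESHAPED COMPOSITION of the row crux `TameUpperNonsurjTower` BY NAME, with ONE named quantity
per row** (for the tenure planner): granted the fine-Selmer reading of Kato 14.5 (3), the CM triple
(Rubin 1991 / Burungale–Flach 2024, row C8), modularity and GZK, the crux follows from the finite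
generation over `ℤ_p` of the dual fine Selmer group `Y(E/ℚ^cyc)` (Coates–Sujatha's statement (A) at
`(E,p)`) on the NON-CM rank-`0` (t′) rows with `E[p]` irreducible and `p`-adic tower not onto. The CM
rows go through `missingUpperBoundAt_of_hasCM_rankZero`, the others through
`missingUpperBoundAt_tame_of_irreducible_of_fineSelmerDual_fg`. Nothing about the finite-generation
statement or the named facts is asserted (conditional: the item is NOT closed by this theorem).
[cite: Kato2004Asterisque, Thm. 14.5 (3) (p. 236), Thm. 12.5 (3) (p. 222), 14.14 (p. 243)]
[cite: Lim2017FineSelmer, §3] [cite: BurungaleFlach2024, Thm. 1.1 and Cor. 2 (p. 4)] -/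
theorem tameUpperNonsurjTower_of_cm_of_fineSelmerDual_fg
    (hKatoA :
      Kato2004.rankZero_padicValNat_sha_add_padicValNat_tamagawa_le_of_additive_potGood_of_irreducible_of_fineSelmerDual_fg)
    (hCM : bsdTriple_of_hasCM_of_L_one_ne_zero) (hmod : hasEntireLFunction_rat)
    (hGZK : rank_eq_analyticRank_of_analyticRank_le_one)
    (hA : ∀ (W : WeierstrassCurve ℚ) [W.IsElliptic] [W.IsGloballyMinimal] (p : ℕ) [Fact p.Prime],
      W.analyticRank = 0 → p ≠ 2 → Addv W p → SubTprime W p → ¬ W.HasCM →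
      W.HasIrreducibleModPGaloisRep p → ¬ (∀ n : ℕ, W.HasSurjectiveModNGaloisRep (p ^ n : ℕ)) →
      ∀ (κ : ZpExtension ℚ p), κ.IsCyclotomic →
        ∃ (γ : Field.absoluteGaloisGroup ℚ) (D : W.FineSelmerDualData κ γ),
          Module.Finite ℤ_[p] (RestrictScalars ℤ_[p] (IwasawaAlgebra p) D.X)) :
    Summit.BirchSwinnertonDyer.BirchSwinnertonDyer.Theses.KatoDescentTamePotSupersingular.TameUpperNonsurjTower := by
  intro W _ _ p _ hr hp2 hadd hT hI hns
  by_cases hcm : W.HasCM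
  · exact missingUpperBoundAt_of_hasCM_rankZero hCM hmod hGZK W p hr hcm
  · exact missingUpperBoundAt_tame_of_irreducible_of_fineSelmerDual_fg hKatoA hGZK hmod W p hr hp2
      hadd hT hI (hA W p hr hp2 hadd hT hcm hI hns)

end Summit.BirchSwinnertonDyer.BirchSwinnertonDyer.Theorems

end
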